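import Mathlib
import Summits.ResolutionOfSingularities.ResolutionOfSingularities.Theorems.HomologicalConductorPersistenceRadicalTower
import Summits.ResolutionOfSingularities.ResolutionOfSingularities.Theorems.SyzygyFlatteningRankOneTerminationStageNormal
import Summits.ResolutionOfSingularities.ResolutionOfSingularities.Theorems.SyzygyFlatteningHigherRankTerminationNrmLocAt
import Summits.ResolutionOfSingularities.ResolutionOfSingularities.Theorems.SyzygyFlatteningHigherRankTerminationRegularStep
import Literature.AlgebraicGeometry.Resolution.RankOneReductionProofs
import HarnessLib

/-!
# Rung S-2 `PersistenceSurface` (stmt-ResolutionOfSingularities-19970) — the NORMALISED CHART IS INSENSITIVE TO A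
# FINITE BIRATIONAL BASE CHANGE: the step from a non-normal stage `T₀` is computed on its normalisation

Route `ResolutionOfSingularities/HomologicalConductor`, chain W4.4b (cell `res-hironaka`), rung S-2
`PersistenceSurface` (stmt-ResolutionOfSingularities-19970), registered stub
`stub_levelFourPersistenceNonnormalOrNonrational'` (L-other′; class Σ8 = NON-NORMAL stage `0`), cell R5 / S-c.
Seat res-L1-w44b-stub-3 (gen 7).  `[OURS · L1 w44b]`; folklore commutative algebra (integral closure is idempotent
and monotone); NOT a statement of the manuscript under review (Hironaka 2017) and no statement of that manuscript is
used; AI-written, weaker than expert review.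

WHY.  The canonical tower only ever sees `T_(m+1) = loc O (nrm (T_m[ca T_m / x]))` (tree
`PersistenceRadical.tower_succ_eq_loc_nrm_affChart`).  At a NON-NORMAL stage `T₀` with normalisation (or any
intermediate module-finite birational ring) `C`, `T₀ ≤ C ≤ nrm T₀`, the normalised chart of an ideal-like set
`I ⊆ T₀` at `x` coincides with the normalised chart, ON `C`, of any set `J` with `I ⊆ J ⊆ C·I` (e.g. the extended
ideal `I·C`): `nrm (T₀[I/x]) = nrm (C[J/x])`.  So the first step out of Σ8 is a point of the normalised blow-up of the
NORMAL ring `C` along `J = ca(T₀)·C` — the ideal pinched by the chain's conductor sandwich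
`𝔠²·ca³(C) ⊆ ca³(T₀) ⊆ 𝔠` (res-L1-w44b-lead-1 p550697/p557460; this seat p555200/p557117/p557649) — and C3′∣Σ8
becomes a statement about normal surface germs and ONE sandwiched ideal (lead-1's S2-LEAD §3 / STATUS 18:33Z reading,
now citable).

* `nrm_nrm` — `nrm (nrm X) = nrm X` (`Frac X = K`; tree `isIntegrallyClosed_nrm` + `nrm_eq_self_of_isIntegrallyClosed`).
* `nrm_eq_nrm_of_le_of_le_nrm` — `X ≤ C ≤ nrm X ⇒ nrm C = nrm X`.
* `nrm_adjoin_union_eq_of_subset_nrm` — `B ≤ C`, `S ⊆ S'`, `C ∪ S' ⊆ nrm (B[S])` ⇒ `nrm (C[S']) = nrm (B[S])`.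
* **`nrm_affChart_eq_of_le_nrm`** — `B ≤ C ≤ nrm B`, `I ⊆ J ⊆ span_C I` ⇒
  `nrm (k[C ∪ {γ/x : γ ∈ J}]) = nrm (k[B ∪ {c/x : c ∈ I}])`.
* **`tower_succ_eq_loc_nrm_affChart_of_le_nrm`** — along the canonical tower: for `T_m ≤ C ≤ nrm T_m` and
  `ca T_m ⊆ J ⊆ span_C (ca T_m)`, `T_(m+1) = loc O (nrm (k[C ∪ {γ/x₀ : γ ∈ J}]))` (`x₀ ∈ ca T_m` nonzero of minimal
  `O`-value).

References (mechanism only): integral closure, [`StacksProject`, Tag 0307 (context)]; all `[folklore]`.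
-/

-- single-problem summit: the doubled namespace component `ResolutionOfSingularities` is forced
set_option linter.dupNamespace false

noncomputable section

namespace Summit.ResolutionOfSingularities.ResolutionOfSingularities.Theorems.HomologicalConductor.PersistenceNrmBaseChange

open Literature.AlgebraicGeometry.Resolution (isFractionRing_subalgebra_of_le)
open Summit.ResolutionOfSingularities.ResolutionOfSingularities.Theorems.SyzygyFlattening
  (mem_nrm_iff self_le_nrm nrm_mono isIntegrallyClosed_nrm nrm_eq_self_of_isIntegrallyClosed)
open Summit.ResolutionOfSingularities.ResolutionOfSingularities.Theorems.NoZeno.Birth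
open Summit.ResolutionOfSingularities.ResolutionOfSingularities.Theorems.HomologicalConductor.PersistenceRadical
  (tower_succ_eq_loc_nrm_affChart)

variable {k K : Type} [Field k] [Field K] [Algebra k K]

/-! ## `nrm` is idempotent; squeezing -/

/-- **`nrm (nrm X) = nrm X`** for a subalgebra `X` with `Frac X = K`: `nrm X` is integrally closed with fraction field
`K`. [folklore] -/
theorem nrm_nrm (X : Subalgebra k K) [IsFractionRing ↥X K] :
    SyzygyFlattening.nrm (SyzygyFlattening.nrm X) = SyzygyFlattening.nrm X := by
  haveI : IsFractionRing ↥(SyzygyFlattening.nrm X) K :=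
    isFractionRing_subalgebra_of_le X (SyzygyFlattening.nrm X) (self_le_nrm X)
  haveI : IsIntegrallyClosed ↥(SyzygyFlattening.nrm X) := isIntegrallyClosed_nrm X
  exact nrm_eq_self_of_isIntegrallyClosed (SyzygyFlattening.nrm X)

/-- **Squeezing**: `X ≤ C ≤ nrm X ⇒ nrm C = nrm X` (`Frac X = K`). [folklore] -/
theorem nrm_eq_nrm_of_le_of_le_nrm (X C : Subalgebra k K) [IsFractionRing ↥X K] (hXC : X ≤ C)
    (hC : C ≤ SyzygyFlattening.nrm X) : SyzygyFlattening.nrm C = SyzygyFlattening.nrm X :=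
  le_antisymm ((nrm_mono hC).trans (nrm_nrm X).le) (nrm_mono hXC)

/-- **Adjoining inside the normalisation does not change it**: for `B ≤ C` and sets `S ⊆ S'` with
`C ∪ S' ⊆ nrm (k[B ∪ S])` (`Frac B = K`), `nrm (k[C ∪ S']) = nrm (k[B ∪ S])`. [folklore] -/
theorem nrm_adjoin_union_eq_of_subset_nrm (B C : Subalgebra k K) [IsFractionRing ↥B K] (hBC : B ≤ C)
    (S S' : Set K) (hSS' : S ⊆ S')
    (hC : (C : Set K) ⊆ SyzygyFlattening.nrm (Algebra.adjoin k ((B : Set K) ∪ S)))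
    (hS' : S' ⊆ SyzygyFlattening.nrm (Algebra.adjoin k ((B : Set K) ∪ S))) :
    SyzygyFlattening.nrm (Algebra.adjoin k ((C : Set K) ∪ S')) =
      SyzygyFlattening.nrm (Algebra.adjoin k ((B : Set K) ∪ S)) := by
  haveI : IsFractionRing ↥(Algebra.adjoin k ((B : Set K) ∪ S)) K :=
    isFractionRing_subalgebra_of_le B _ (fun b hb => Algebra.subset_adjoin (Or.inl hb))
  refine nrm_eq_nrm_of_le_of_le_nrm _ _ (Algebra.adjoin_mono (Set.union_subset_union hBC hSS')) ?_
  exact Algebra.adjoin_le (Set.union_subset hC hS')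

/-! ## The affine chart of an ideal-like set: base change to an intermediate ring `B ≤ C ≤ nrm B` -/

/-- For `J ⊆ span_C I` (subsets of `K`, `C` a subalgebra), the quotients `γ/x`, `γ ∈ J`, lie in
`k[C ∪ {c/x : c ∈ I}]`. [folklore] -/
theorem mul_inv_mem_adjoin_of_mem_span (C : Subalgebra k K) (I J : Set K)
    (hJ : J ⊆ (Submodule.span ↥C I : Submodule ↥C K)) (x : K) {γ : K} (hγ : γ ∈ J) :
    γ * x⁻¹ ∈ Algebra.adjoin k ((C : Set K) ∪ {y : K | ∃ c ∈ I, y = c * x⁻¹}) := by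
  have hγ' : γ ∈ (Submodule.span ↥C I : Submodule ↥C K) := hJ hγ
  refine Submodule.span_induction (p := fun γ _ => γ * x⁻¹ ∈
      Algebra.adjoin k ((C : Set K) ∪ {y : K | ∃ c ∈ I, y = c * x⁻¹})) ?_ ?_ ?_ ?_ hγ'
  · intro c hc
    exact Algebra.subset_adjoin (Or.inr ⟨c, hc, rfl⟩)
  · rw [zero_mul]
    exact Subalgebra.zero_mem _
  · intro a b _ _ ha hb
    rw [add_mul]
    exact Subalgebra.add_mem _ ha hb
  · intro s a _ ha
    rw [Algebra.smul_def, mul_assoc]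
    refine Subalgebra.mul_mem _ (Algebra.subset_adjoin (Or.inl ?_)) ha
    exact s.2

/-- **The normalised affine chart is insensitive to an intermediate ring `B ≤ C ≤ nrm B`** (`Frac B = K`): for
`I ⊆ J ⊆ span_C I`, `nrm (k[C ∪ {γ/x : γ ∈ J}]) = nrm (k[B ∪ {c/x : c ∈ I}])`.  (Case in point: `B = T₀` a non-normal
stage, `C` its normalisation, `I = ca T₀`, `J = ca(T₀)·C`.) [folklore] -/
theorem nrm_affChart_eq_of_le_nrm (B C : Subalgebra k K) [IsFractionRing ↥B K] (hBC : B ≤ C)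
    (hCB : C ≤ SyzygyFlattening.nrm B) (I J : Set K) (hIJ : I ⊆ J)
    (hJ : J ⊆ (Submodule.span ↥C I : Submodule ↥C K)) (x : K) :
    SyzygyFlattening.nrm (Algebra.adjoin k ((C : Set K) ∪ {y : K | ∃ γ ∈ J, y = γ * x⁻¹})) =
      SyzygyFlattening.nrm (Algebra.adjoin k ((B : Set K) ∪ {y : K | ∃ c ∈ I, y = c * x⁻¹})) := by
  have hle : Algebra.adjoin k ((B : Set K) ∪ {y : K | ∃ c ∈ I, y = c * x⁻¹}) ≤
      SyzygyFlattening.nrm (Algebra.adjoin k ((B : Set K) ∪ {y : K | ∃ c ∈ I, y = c * x⁻¹})) := self_le_nrm _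
  have hCle : (C : Set K) ⊆ SyzygyFlattening.nrm (Algebra.adjoin k ((B : Set K) ∪ {y : K | ∃ c ∈ I, y = c * x⁻¹})) :=
    fun γ hγ => nrm_mono (fun b hb => Algebra.subset_adjoin (Or.inl hb)) (hCB hγ)
  refine nrm_adjoin_union_eq_of_subset_nrm B C hBC _ _ (fun y ⟨c, hc, hy⟩ => ⟨c, hIJ hc, hy⟩) hCle ?_
  rintro y ⟨γ, hγ, rfl⟩
  -- `γ/x ∈ k[C ∪ {c/x}] ≤ nrm (k[B ∪ {c/x}])`
  have hadj : Algebra.adjoin k ((C : Set K) ∪ {y : K | ∃ c ∈ I, y = c * x⁻¹}) ≤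
      SyzygyFlattening.nrm (Algebra.adjoin k ((B : Set K) ∪ {y : K | ∃ c ∈ I, y = c * x⁻¹})) :=
    Algebra.adjoin_le (Set.union_subset hCle fun y hy => hle (Algebra.subset_adjoin (Or.inr hy)))
  exact hadj (mul_inv_mem_adjoin_of_mem_span C I J hJ x hγ)

/-! ## Along the canonical tower -/

/-- **The step out of a non-normal stage is computed on the normalisation.**  For the canonical tower
`T_m = tower O A m` (route vocabulary `NoZeno.Birth`), an intermediate ring `T_m ≤ C ≤ nrm T_m`, a set `J` with
`ca T_m ⊆ J ⊆ span_C (ca T_m)` (e.g. the extended ideal `ca(T_m)·C`), and `x₀ ∈ ca T_m` nonzero of minimal `O`-value: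
`T_(m+1) = loc O (nrm (k[C ∪ {γ/x₀ : γ ∈ J}]))` (tree `tower_succ_eq_loc_nrm_affChart` + `nrm_affChart_eq_of_le_nrm`).
[folklore] -/
theorem tower_succ_eq_loc_nrm_affChart_of_le_nrm (O : ValuationSubring K) (A : Subalgebra k K) (m : ℕ)
    [IsFractionRing ↥(tower O A m) K] (hTO : (tower O A m).toSubring ≤ O.toSubring) {x₀ : K}
    (hx₀ : x₀ ∈ ca (tower O A m)) (hx₀0 : x₀ ≠ 0) (hadm : ∀ c ∈ ca (tower O A m), c * x₀⁻¹ ∈ O)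
    (C : Subalgebra k K) (hTC : tower O A m ≤ C) (hCn : C ≤ nrm (tower O A m)) (J : Set K)
    (hIJ : ca (tower O A m) ⊆ J) (hJ : J ⊆ (Submodule.span ↥C (ca (tower O A m)) : Submodule ↥C K)) :
    tower O A (m + 1) = loc O (nrm (Algebra.adjoin k ((C : Set K) ∪ {y : K | ∃ γ ∈ J, y = γ * x₀⁻¹}))) := by
  rw [tower_succ_eq_loc_nrm_affChart O A m hTO hx₀ hx₀0 hadm, nrm_eq_nrm, nrm_eq_nrm]
  rw [nrm_eq_nrm] at hCn
  rw [nrm_affChart_eq_of_le_nrm (tower O A m) C hTC hCn _ J hIJ hJ x₀]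

end Summit.ResolutionOfSingularities.ResolutionOfSingularities.Theorems.HomologicalConductor.PersistenceNrmBaseChange

end
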